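import Literature.NumberTheory.Transcendental.NesterenkoUResultantChow
import Literature.NumberTheory.Transcendental.NesterenkoGenericPoints
import HarnessLib

/-!
# The `u`-resultant of the Chow form of a prime with a form, VI: its degree is `deg 𝔭 · deg Q` (LNM 1752 Ch. 3 Prop. 4.11 1), route B)

`Literature/NumberTheory/Transcendental/NesterenkoUResultantDegree.lean`. For a homogeneous prime
`𝔭` of rank `s + 1` (`2 ≤ s + 1 ≤ m`) and a form `Q ∉ 𝔭` of degree `d ≥ 1` with integer model
`Q₀`, the `u`-resultant `G = uResultant 𝔭 s d Q₀` (a Chow form by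
`NesterenkoUResultantChow.lean`, hence homogeneous in each group `uᵢ`) has degree EXACTLY
`deg 𝔭 · d` in the group `u₁` (`blockDeg_uResultant`), so that the unmixed ideal `J` with
`chowForm J s = c · G` has `deg J = deg 𝔭 · deg Q` — part 1) of Proposition 4.11 (with equality;
this is Bézout's theorem counted with Nesterenko's exponents).

Proof (specialisation at a generic complex point, `exists_split_complexSpec`): at `z` generic
and at `z' = (2 z₁, z₂, …, z_s)` (also generic), `F(z'; ·) = 2^{deg 𝔭} F(z; ·)`, so the two
splittings of `F(z'; ·)` give `G(z') = 2^{deg 𝔭 · d} G(z)` (independence of the split norm of the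
splitting), while `G(z') = 2^{deg_{u₁} G} G(z)` by homogeneity and `G(z) ≠ 0`.

No definitions, no named facts.

## References

* [NesterenkoPhilippon2001] Yu. V. Nesterenko, P. Philippon (eds.), *Introduction to Algebraic
  Independence Theory*, LNM 1752, Springer 2001, Ch. 3 §4, Prop. 4.11 1) (p. 41).
* [Nes10] Yu. V. Nesterenko, Proc. Steklov Inst. Math. 218 (1997) 294–331, Prop. 1.4.
-/

noncomputable section

open MvPolynomial
open Literature.NumberTheory.Transcendental.PhilipponMain

attribute [local instance] MvPolynomial.gradedAlgebra

namespace Literature.NumberTheory.Transcendental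

namespace Nesterenko

variable {m : ℕ}

/-! ### Rescaling a group of variables -/

/-- Evaluating after rescaling the group `uᵢ` by `c` is evaluating at the rescaled point.
[folklore] -/
theorem aeval_scaleU {L : Type*} [CommRing L] [Algebra ℚ L] {r : ℕ} (i : Fin r) (c : ℚ)
    (x : Fin r × Fin (m + 1) → L) (F : RU r m) :
    aeval x (scaleU r m i c F) =
      aeval (fun w => if w.1 = i then algebraMap ℚ L c * x w else x w) F := by
  have hfg : (fun w : Fin r × Fin (m + 1) =>
      aeval x (if w.1 = i then C c * X w else (X w : RU r m))) =
      fun w => if w.1 = i then algebraMap ℚ L c * x w else x w := by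
    funext w
    split_ifs with h
    · rw [map_mul, aeval_C, aeval_X]
    · rw [aeval_X]
  rw [scaleU, comp_aeval_apply, hfg]

/-- `scaleU` is injective (for `c ≠ 0`). [folklore] -/
theorem scaleU_injective {r : ℕ} (i : Fin r) {c : ℚ} (hc : c ≠ 0) :
    Function.Injective (scaleU r m i c) := by
  have key : ∀ H, scaleU r m i c⁻¹ (scaleU r m i c H) = H := fun H => by
    have h := scaleU_scaleU_inv r m i (inv_ne_zero hc) H
    simp only [inv_inv] at h
    exact h
  intro F G h
  rw [← key F, ← key G, h]

/-- A polynomial which is weighted-homogeneous of weight `n` in the group `uᵢ` is multiplied by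
`c^n` under `uᵢ ↦ c uᵢ`. [folklore] -/
theorem scaleU_eq_C_pow_mul {r : ℕ} {i : Fin r} {G : RU r m} {n : ℕ}
    (hG : IsWeightedHomogeneous (fun v : Fin r × Fin (m + 1) => if v.1 = i then (1 : ℕ) else 0) G n)
    (c : ℚ) : scaleU r m i c G = C (c ^ n) * G := by
  classical
  ext e
  rw [coeff_scaleU, coeff_C_mul]
  by_cases he : e ∈ G.support
  · rw [← weight_block_eq_bdeg, hG (mem_support_iff.mp he)]
  · rw [notMem_support_iff.mp he, mul_zero, mul_zero]

/-- In particular for the Chow form of `𝔭`: `F(…, c uᵢ, …) = c^{deg 𝔭} F`.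
[cite: NesterenkoPhilippon2001, Ch. 3, remark after Prop. 4.4 (p. 38)] -/
theorem scaleU_chowForm {r : ℕ} (hr : 0 < r) (𝔭 : Ideal (Rx m)) (i : Fin r) (c : ℚ) :
    scaleU r m i c (chowForm 𝔭 r) = C (c ^ ideg 𝔭 r) * chowForm 𝔭 r :=
  scaleU_eq_C_pow_mul (chowForm_isWeightedHomogeneous 𝔭 hr i) c

/-! ### The `u`-resultant is homogeneous in each group -/

section Setting

variable {s : ℕ} {𝔭 : Ideal (Rx m)} {Q : Rx m} {d : ℕ} {q : ℚ} {Q₀ : MvPolynomial (Fin (m + 1)) ℤ}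

/-- **The `u`-resultant is homogeneous in each group `uᵢ`** of degree `deg_{u₁} G` (it is a Chow
form up to a constant). [cite: NesterenkoPhilippon2001, Ch. 3, remark after Prop. 4.4 (p. 38)] -/
theorem uResultant_isWeightedHomogeneous (hs : 1 ≤ s) (hsm : s + 1 ≤ m) (h𝔭 : 𝔭.IsPrime)
    (hhom : 𝔭.IsHomogeneous (homogeneousSubmodule (Fin (m + 1)) ℚ))
    (hunm : IsUnmixedOfRank 𝔭 (s + 1)) (hQ : Q.IsHomogeneous d) (hd : 1 ≤ d) (hQ𝔭 : Q ∉ 𝔭)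
    (hq : q ≠ 0) (hQQ₀ : Q = C q * MvPolynomial.map (Int.castRingHom ℚ) Q₀)
    (hQ₀ : Q₀.IsHomogeneous d) (i : Fin s) :
    IsWeightedHomogeneous (fun v : Fin s × Fin (m + 1) => if v.1 = i then (1 : ℕ) else 0)
      (uResultant 𝔭 s d Q₀) (blockDeg (uResultant 𝔭 s d Q₀) ⟨0, hs⟩) := by
  obtain ⟨J, c, -, -, -, hc, hJ⟩ :=
    exists_cycle_ideal_uResultant hs hsm h𝔭 hhom hunm hQ hd hQ𝔭 hq hQQ₀ hQ₀
  have hG : uResultant 𝔭 s d Q₀ = C c⁻¹ * chowForm J s := by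
    rw [hJ, ← mul_assoc, ← map_mul, inv_mul_cancel₀ hc, C_1, one_mul]
  have hwh : ∀ i' : Fin s, IsWeightedHomogeneous
      (fun v : Fin s × Fin (m + 1) => if v.1 = i' then (1 : ℕ) else 0)
      (uResultant 𝔭 s d Q₀) (ideg J s) := fun i' => by
    rw [hG]
    exact (chowForm_isWeightedHomogeneous J hs i').C_mul _
  have hG0 : uResultant 𝔭 s d Q₀ ≠ 0 := uResultant_ne_zero hs h𝔭 hhom hunm hQ hd hQ𝔭 hQQ₀ hQ₀
  rw [blockDeg_eq_of_isWeightedHomogeneous (hwh ⟨0, hs⟩) hG0]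
  exact hwh i

/-- **Proposition 4.11 1) with equality: `deg_{u₁} G = deg 𝔭 · deg Q`.**
[cite: NesterenkoPhilippon2001, Ch. 3 Prop. 4.11 1) (p. 41)] -/
theorem blockDeg_uResultant (hs : 1 ≤ s) (hsm : s + 1 ≤ m) (h𝔭 : 𝔭.IsPrime)
    (hhom : 𝔭.IsHomogeneous (homogeneousSubmodule (Fin (m + 1)) ℚ))
    (hunm : IsUnmixedOfRank 𝔭 (s + 1)) (hQ : Q.IsHomogeneous d) (hd : 1 ≤ d) (hQ𝔭 : Q ∉ 𝔭)
    (hq : q ≠ 0) (hQQ₀ : Q = C q * MvPolynomial.map (Int.castRingHom ℚ) Q₀)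
    (hQ₀ : Q₀.IsHomogeneous d) :
    blockDeg (uResultant 𝔭 s d Q₀) ⟨0, hs⟩ = ideg 𝔭 (s + 1) * d := by
  classical
  have hdim : ringKrullDim (Rx m ⧸ 𝔭) = (s + 1 : ℕ) :=
    ringKrullDim_quotient_eq_of_isUnmixedOfRank h𝔭 hunm
  have hG0 : uResultant 𝔭 s d Q₀ ≠ 0 := uResultant_ne_zero hs h𝔭 hhom hunm hQ hd hQ𝔭 hQQ₀ hQ₀
  have hGwh := uResultant_isWeightedHomogeneous hs hsm h𝔭 hhom hunm hQ hd hQ𝔭 hq hQQ₀ hQ₀ ⟨0, hs⟩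
  -- a generic point `z` and its rescaling `z'`
  obtain ⟨z, hz⟩ := exists_injective_aeval (Fin s × Fin (m + 1))
  set z' : Fin s × Fin (m + 1) → ℂ :=
    fun w => if w.1 = (⟨0, hs⟩ : Fin s) then algebraMap ℚ ℂ 2 * z w else z w with hz'
  have haz' : ∀ H : RU s m, aeval z' H = aeval z (scaleU s m ⟨0, hs⟩ 2 H) := fun H => by
    rw [aeval_scaleU]
  have hz'inj : Function.Injective (aeval z' : RU s m →ₐ[ℚ] ℂ) := by
    intro H H' h
    rw [haz', haz'] at h
    exact scaleU_injective ⟨0, hs⟩ two_ne_zero (hz h)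
  -- the two specialisations
  obtain ⟨cz, bz, hcz, hbz, -, -, hF, hGz⟩ := exists_split_complexSpec h𝔭 hhom hdim hQ₀ hz
  obtain ⟨cz', bz', hcz', hbz', -, -, hF', hGz'⟩ := exists_split_complexSpec h𝔭 hhom hdim hQ₀ hz'inj
  -- `F(z'; ·) = 2^D F(z; ·)`
  have hFF : MvPolynomial.map (aeval z' : RU s m →ₐ[ℚ] ℂ) (splitLast s m (chowForm 𝔭 (s + 1))) =
      C ((2 : ℂ) ^ ideg 𝔭 (s + 1)) *
        MvPolynomial.map (aeval z : RU s m →ₐ[ℚ] ℂ) (splitLast s m (chowForm 𝔭 (s + 1))) := by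
    refine MvPolynomial.funext fun v => ?_
    rw [map_mul, eval_C, eval_map_splitLast, eval_map_splitLast]
    have hpt : lastCombine (fun w => (aeval z' : RU s m →ₐ[ℚ] ℂ) (X w)) v =
        fun w => if w.1 = Fin.castSucc (⟨0, hs⟩ : Fin s) then algebraMap ℚ ℂ 2 *
          lastCombine (fun w => (aeval z : RU s m →ₐ[ℚ] ℂ) (X w)) v w
        else lastCombine (fun w => (aeval z : RU s m →ₐ[ℚ] ℂ) (X w)) v w := by
      funext ⟨i, j⟩
      induction i using Fin.lastCases with
      | last =>
        simp only [lastCombine_last]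
        rw [if_neg (Fin.castSucc_lt_last _).ne']
      | cast i =>
        simp only [lastCombine_castSucc, aeval_X, Fin.castSucc_inj, hz']
    rw [hpt, ← aeval_scaleU, scaleU_chowForm (Nat.succ_pos s), map_mul, aeval_C, map_pow,
      eq_ratCast, Rat.cast_ofNat]
  -- hence `G(z') = 2^{D d} G(z)` by independence of the split norm
  have h1 : aeval z' (uResultant 𝔭 s d Q₀) = (2 : ℂ) ^ (ideg 𝔭 (s + 1) * d) *
      aeval z (uResultant 𝔭 s d Q₀) := by
    have hFF' := hFF
    rw [hF', hF, ← mul_assoc, ← map_mul] at hFF'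
    rw [hGz', hGz, ← splitNorm_def, ← splitNorm_def, splitNorm_eq_of_eq hQ₀ hbz' hbz hcz' hFF',
      splitNorm_smul_left, pow_mul]
  -- and `G(z') = 2^N G(z)` by homogeneity
  have h2 : aeval z' (uResultant 𝔭 s d Q₀) =
      (2 : ℂ) ^ blockDeg (uResultant 𝔭 s d Q₀) ⟨0, hs⟩ * aeval z (uResultant 𝔭 s d Q₀) := by
    rw [haz', scaleU_eq_C_pow_mul hGwh, map_mul, aeval_C, map_pow, eq_ratCast, Rat.cast_ofNat]
  have hGz0 : aeval z (uResultant 𝔭 s d Q₀) ≠ 0 := fun h => hG0 (hz (by rw [h, map_zero]))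
  have h3 : (2 : ℂ) ^ blockDeg (uResultant 𝔭 s d Q₀) ⟨0, hs⟩ = 2 ^ (ideg 𝔭 (s + 1) * d) :=
    mul_right_cancel₀ hGz0 (h2.symm.trans h1)
  have h4 : ((2 ^ blockDeg (uResultant 𝔭 s d Q₀) ⟨0, hs⟩ : ℕ) : ℂ) =
      ((2 ^ (ideg 𝔭 (s + 1) * d) : ℕ) : ℂ) := by
    push_cast; exact h3
  exact Nat.pow_right_injective le_rfl (Nat.cast_injective h4)

end Setting

end Nesterenko

end Literature.NumberTheory.Transcendental

end
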